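import Literature.RingTheory.FormalGroups.LazardRingGenerators
import Literature.RingTheory.FormalGroups.FormalGroupStrictIsoTransport
import Mathlib.Algebra.TrivSqZeroExt.Basic
import Mathlib.Data.Nat.Choose.Sum
import HarnessLib

/-!
# The universal strict isomorphism to the additive law and the linear coefficients of Lazard's generators
# ([Lazard1955] §II–III; [Hazewinkel1978] §5.5)

Topic `Literature/RingTheory/FormalGroups`; namespace `Literature.RingTheory.FormalGroups`.  Plumbing definitions
(`LazardRing.logSeries`, `LazardRing.expSeries`, `LazardRing.addLaw`, `LazardRing.phiHom`, `LazardRing.dualEps`,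
`LazardRing.dualHom`, `LazardRing.gSer`, `LazardRing.hSer`) and fully proved theorems; no named fact, no instance, no notation,
no `sorry`.

Over `ℤ[b₀, b₁, …] = MvPolynomial ℕ ℤ` let `g(T) = T + Σ_k b_k T^{k+2}` (`logSeries`) and `H_b(X,Y) = g⁻¹(g(X) + g(Y))`
(`addLaw`, the transport ★ `transport` of `𝔾ₐ` along `g`): the UNIVERSAL law strictly isomorphic to the additive one.  Its
classifying map `Φ : L → ℤ[b]` (`phiHom = LazardRing.lift addLaw`) is read in the dual numbers `ℤ[ε]/ε²` through
`ρ_k : b_j ↦ [j = k] ε` (`dualHom k`): there `g` becomes `T + εT^{k+2}`, `g⁻¹` becomes `T − εT^{k+2}` and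
`H_b ↦ X + Y − ε((X+Y)^{k+2} − X^{k+2} − Y^{k+2}) = X + Y − ε·ν(k+2)·C_{k+2}(X,Y)` (`toPowerSeries_addLaw_map_dualHom`).  Since
`ρ_k` reads off the constant term and the coefficient of `b_k` (`fst_dualHom`, `snd_dualHom`), we obtain the two facts about
Lazard's generators `t_m = Σ_b w_b ā_{(b,m−b)}` (file `LazardRingGenerators`) that drive Lazard's theorem:
`Φ(t_{i+2})` has NO CONSTANT TERM and its LINEAR PART is `−ν(i+2)·b_i` (`coeff_zero_phiHom_tGen`,
`coeff_single_phiHom_tGen`), where `ν(m) = Σ_b w_b C(m,b)` is Lazard's `ν` (★ `lazardNu`).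

## References
* [Lazard1955] M. Lazard, *Sur les groupes de Lie formels à un paramètre*, Bull. SMF 83 (1955), §II (2.2)–(2.3), Thm. II, §III.
* [Hazewinkel1978] M. Hazewinkel, *Formal Groups and Applications* (1978), §5.5.
-/

noncomputable section

namespace Literature.RingTheory.FormalGroups

open _root_.MvPowerSeries (HasSubst coeff)
open Finset

namespace LazardRing

/-! ## §1 The universal strict isomorphism to the additive law over `ℤ[b]` -/

/-- **The generic strict series** `g(T) = T + Σ_{k ≥ 0} b_k T^{k+2} ∈ ℤ[b]⟦T⟧`. [cite: Lazard1955, §II (2.9)] -/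
def logSeries : PowerSeries (MvPolynomial ℕ ℤ) :=
  PowerSeries.mk fun n => if n = 1 then 1 else if 2 ≤ n then MvPolynomial.X (n - 2) else 0

/-- Coefficients of `g`. [cite: Lazard1955, §II (2.9)] -/
theorem coeff_logSeries (n : ℕ) : PowerSeries.coeff n logSeries =
    if n = 1 then 1 else if 2 ≤ n then MvPolynomial.X (n - 2) else 0 := by
  rw [logSeries, PowerSeries.coeff_mk]

/-- `g(0) = 0`. [cite: Lazard1955, §II (2.9)] -/
theorem constantCoeff_logSeries : logSeries.constantCoeff = 0 := by
  rw [← PowerSeries.coeff_zero_eq_constantCoeff_apply, coeff_logSeries]; simp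

/-- `g ≡ T (mod deg 2)`. [cite: Lazard1955, §II (2.9)] -/
theorem coeff_one_logSeries : PowerSeries.coeff 1 logSeries = 1 := by
  rw [coeff_logSeries, if_pos rfl]

/-- `g` has a two-sided strict compositional inverse. [cite: Lazard1955, §II (2.9)] -/
theorem exists_expSeries : ∃ χ : PowerSeries (MvPolynomial ℕ ℤ), χ.constantCoeff = 0 ∧ PowerSeries.coeff 1 χ = 1 ∧
    PowerSeries.subst χ logSeries = PowerSeries.X ∧ PowerSeries.subst logSeries χ = PowerSeries.X :=
  exists_inverse_of_coeff_one_eq_one constantCoeff_logSeries coeff_one_logSeries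

/-- **The inverse series** `g⁻¹`. [cite: Lazard1955, §II (2.9)] -/
def expSeries : PowerSeries (MvPolynomial ℕ ℤ) := Classical.choose exists_expSeries

/-- The defining properties of `g⁻¹`: `g⁻¹(0) = 0`, `g⁻¹ ≡ T`, `g(g⁻¹(T)) = T = g⁻¹(g(T))`. [cite: Lazard1955, §II (2.9)] -/
theorem expSeries_spec : expSeries.constantCoeff = 0 ∧ PowerSeries.coeff 1 expSeries = 1 ∧
    PowerSeries.subst expSeries logSeries = PowerSeries.X ∧ PowerSeries.subst logSeries expSeries = PowerSeries.X :=
  Classical.choose_spec exists_expSeries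

/-- **The universal law strictly isomorphic to the additive law**: `H_b(X,Y) = g⁻¹(g(X) + g(Y))` over `ℤ[b]` (transport of
`𝔾ₐ` along `g`). [cite: Lazard1955, §II (2.10)] -/
def addLaw : FormalGroup (MvPolynomial ℕ ℤ) :=
  transport FormalGroup.𝔾ₐ constantCoeff_logSeries expSeries_spec.1 expSeries_spec.2.2.1

/-- `H_b` is commutative. [cite: Lazard1955, §II (2.10)] -/
theorem addLaw_isComm : addLaw.IsComm :=
  transport_isComm FormalGroup.𝔾ₐ constantCoeff_logSeries expSeries_spec.1 expSeries_spec.2.2.1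

/-- **The classifying map `Φ : L → ℤ[b]` of `H_b`.** [cite: Lazard1955, §II Thm. II] -/
def phiHom : LazardRing →+* MvPolynomial ℕ ℤ := @lift _ _ addLaw addLaw_isComm

/-- `Φ(ā_d)` is the `d`-th coefficient of `H_b` (interior `d`). [cite: Lazard1955, §II Thm. II] -/
theorem phiHom_gen {d : Fin 2 →₀ ℕ} (hd : 0 < d 0 ∧ 0 < d 1) : phiHom (gen d) = coeff d addLaw.toPowerSeries := by
  rw [phiHom, @lift_gen _ _ addLaw addLaw_isComm, coeffVal, if_pos hd]

/-! ## §2 Reading `H_b` in the dual numbers `ℤ[ε]/ε²` -/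

/-- `ε = (0, 1) ∈ ℤ ⊕ ℤε`. [cite: Lazard1955, §III] -/
def dualEps : TrivSqZeroExt ℤ ℤ := TrivSqZeroExt.inr 1

/-- `ε² = 0`. [cite: Lazard1955, §III] -/
@[simp] theorem dualEps_mul_dualEps : dualEps * dualEps = 0 := TrivSqZeroExt.inr_mul_inr ℤ 1 1

/-- `fst ε = 0`. [cite: Lazard1955, §III] -/
@[simp] theorem fst_dualEps : dualEps.fst = 0 := rfl

/-- `snd ε = 1`. [cite: Lazard1955, §III] -/
@[simp] theorem snd_dualEps : dualEps.snd = 1 := rfl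

/-- **`ρ_k : ℤ[b] → ℤ[ε]/ε²`**, `b_j ↦ [j = k] ε`. [cite: Lazard1955, §III] -/
def dualHom (k : ℕ) : MvPolynomial ℕ ℤ →+* TrivSqZeroExt ℤ ℤ :=
  MvPolynomial.eval₂Hom (Int.castRingHom _) fun j => if j = k then dualEps else 0

/-- `ρ_k(b_j) = [j = k] ε`. [cite: Lazard1955, §III] -/
@[simp] theorem dualHom_X (k j : ℕ) : dualHom k (MvPolynomial.X j) = if j = k then dualEps else 0 := by
  simp [dualHom]

/-- **`ρ_k` reads off the constant term and the coefficient of `b_k`**: `ρ_k(p) = p(0) + p_{b_k} ε`. [cite: Lazard1955, §III] -/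
theorem dualHom_eq (k : ℕ) (p : MvPolynomial ℕ ℤ) :
    (dualHom k p).fst = MvPolynomial.coeff 0 p ∧ (dualHom k p).snd = MvPolynomial.coeff (Finsupp.single k 1) p := by
  classical
  induction p using MvPolynomial.induction_on with
  | C z =>
    rw [dualHom, MvPolynomial.eval₂Hom_C, Int.coe_castRingHom, TrivSqZeroExt.fst_intCast, TrivSqZeroExt.snd_intCast,
      MvPolynomial.coeff_zero_C, MvPolynomial.coeff_C, if_neg (Finsupp.single_ne_zero.mpr one_ne_zero).symm]
    exact ⟨rfl, rfl⟩
  | add p q hp hq =>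
    exact ⟨by rw [map_add, TrivSqZeroExt.fst_add, hp.1, hq.1, MvPolynomial.coeff_add],
      by rw [map_add, TrivSqZeroExt.snd_add, hp.2, hq.2, MvPolynomial.coeff_add]⟩
  | mul_X p j hp =>
    have hfst : (dualHom k (MvPolynomial.X j)).fst = 0 := by rw [dualHom_X]; split_ifs <;> rfl
    have hsnd : (dualHom k (MvPolynomial.X j)).snd = if j = k then 1 else 0 := by
      rw [dualHom_X]; split_ifs <;> rfl
    refine ⟨?_, ?_⟩
    · rw [map_mul, TrivSqZeroExt.fst_mul, hfst, mul_zero, MvPolynomial.coeff_mul_X', if_neg (by simp)]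
    · rw [map_mul, TrivSqZeroExt.snd_mul, hfst, hp.1, hsnd, MulOpposite.op_zero, zero_smul, add_zero,
        MvPolynomial.coeff_mul_X', smul_eq_mul]
      by_cases hjk : j = k
      · subst hjk; rw [if_pos rfl, if_pos (by simp), mul_one, tsub_self]
      · rw [if_neg hjk, mul_zero, if_neg (by simpa using hjk)]

/-- The constant term through `ρ_k`. [cite: Lazard1955, §III] -/
theorem fst_dualHom (k : ℕ) (p : MvPolynomial ℕ ℤ) : (dualHom k p).fst = MvPolynomial.coeff 0 p := (dualHom_eq k p).1

/-- The coefficient of `b_k` through `ρ_k`. [cite: Lazard1955, §III] -/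
theorem snd_dualHom (k : ℕ) (p : MvPolynomial ℕ ℤ) : (dualHom k p).snd = MvPolynomial.coeff (Finsupp.single k 1) p :=
  (dualHom_eq k p).2

/-- `g` read in `ℤ[ε]/ε²` through `ρ_k`: `T + ε T^{k+2}`. [cite: Lazard1955, §III] -/
def gSer (k : ℕ) : PowerSeries (TrivSqZeroExt ℤ ℤ) := PowerSeries.X + PowerSeries.C dualEps * PowerSeries.X ^ (k + 2)

/-- Its inverse: `T − ε T^{k+2}`. [cite: Lazard1955, §III] -/
def hSer (k : ℕ) : PowerSeries (TrivSqZeroExt ℤ ℤ) := PowerSeries.X - PowerSeries.C dualEps * PowerSeries.X ^ (k + 2)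

/-- **`ρ_k(g) = T + ε T^{k+2}`.** [cite: Lazard1955, §III] -/
theorem map_dualHom_logSeries (k : ℕ) : PowerSeries.map (dualHom k) logSeries = gSer k := by
  refine PowerSeries.ext fun n => ?_
  rw [PowerSeries.coeff_map, coeff_logSeries, gSer, map_add, PowerSeries.coeff_X, PowerSeries.coeff_C_mul,
    PowerSeries.coeff_X_pow]
  by_cases h1 : n = 1
  · subst h1; simp
  · rw [if_neg h1, if_neg h1, zero_add]
    by_cases h2 : 2 ≤ n
    · rw [if_pos h2, dualHom_X]
      by_cases hk : n = k + 2
      · subst hk; simp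
      · rw [if_neg (by omega), if_neg hk, mul_zero]
    · rw [if_neg h2, map_zero, if_neg (by omega), mul_zero]

/-- `c · (S + E)^q = c · S^q` when `c E = 0` (square-zero binomial expansion, plumbing). [folklore] -/
private theorem mul_add_pow_of_mul_eq_zero' {B : Type*} [CommRing B] (c S E : B) (h : c * E = 0) (q : ℕ) :
    c * (S + E) ^ q = c * S ^ q := by
  obtain ⟨W, hW⟩ := sub_dvd_pow_sub_pow (S + E) S q
  rw [add_sub_cancel_left] at hW
  have : (S + E) ^ q = S ^ q + E * W := by rw [← hW]; ring
  rw [this, mul_add, ← mul_assoc, h, zero_mul, add_zero]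

/-- `C ε · C ε = 0` in any series ring over `ℤ[ε]/ε²` (plumbing). [cite: Lazard1955, §III] -/
theorem C_dualEps_mul_C_dualEps {τ : Type*} :
    (MvPowerSeries.C dualEps : MvPowerSeries τ (TrivSqZeroExt ℤ ℤ)) * MvPowerSeries.C dualEps = 0 := by
  rw [← map_mul, dualEps_mul_dualEps, map_zero]

/-- Substitution into `T + εT^{k+2}`: `g_k(u) = u + ε u^{k+2}`. [cite: Lazard1955, §III] -/
theorem subst_gSer (k : ℕ) {τ : Type*} {u : MvPowerSeries τ (TrivSqZeroExt ℤ ℤ)} (hu : PowerSeries.HasSubst u) :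
    PowerSeries.subst u (gSer k) = u + MvPowerSeries.C dualEps * u ^ (k + 2) := by
  rw [gSer, PowerSeries.subst_add hu, PowerSeries.subst_X hu, PowerSeries.subst_mul hu, PowerSeries.subst_C,
    PowerSeries.subst_pow hu, PowerSeries.subst_X hu]

/-- Substitution into `T − εT^{k+2}`: `h_k(u) = u − ε u^{k+2}`. [cite: Lazard1955, §III] -/
theorem subst_hSer (k : ℕ) {τ : Type*} {u : MvPowerSeries τ (TrivSqZeroExt ℤ ℤ)} (hu : PowerSeries.HasSubst u) :
    PowerSeries.subst u (hSer k) = u - MvPowerSeries.C dualEps * u ^ (k + 2) := by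
  rw [hSer, PowerSeries.subst_sub hu, PowerSeries.subst_X hu, PowerSeries.subst_mul hu, PowerSeries.subst_C,
    PowerSeries.subst_pow hu, PowerSeries.subst_X hu]

/-- `h_k(0) = 0` (plumbing). [cite: Lazard1955, §III] -/
theorem constantCoeff_hSer (k : ℕ) : (hSer k).constantCoeff = 0 := by
  rw [hSer, map_sub, map_mul, map_pow, PowerSeries.constantCoeff_X, zero_pow (by omega), mul_zero, sub_zero]

/-- `g_k(0) = 0` (plumbing). [cite: Lazard1955, §III] -/
theorem constantCoeff_gSer (k : ℕ) : (gSer k).constantCoeff = 0 := by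
  rw [gSer, map_add, map_mul, map_pow, PowerSeries.constantCoeff_X, zero_pow (by omega), mul_zero, add_zero]

/-- **`h_k(g_k(T)) = T`** (`ε² = 0`). [cite: Lazard1955, §III] -/
theorem subst_gSer_hSer (k : ℕ) : PowerSeries.subst (gSer k) (hSer k) = PowerSeries.X := by
  have hg : PowerSeries.HasSubst (gSer k) := PowerSeries.HasSubst.of_constantCoeff_zero' (constantCoeff_gSer k)
  rw [subst_hSer k hg]
  change gSer k - MvPowerSeries.C dualEps * gSer k ^ (k + 2) = PowerSeries.X
  rw [gSer, mul_add_pow_of_mul_eq_zero' _ _ _ (by rw [← mul_assoc]; exact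
    (congrArg (· * _) C_dualEps_mul_C_dualEps).trans (zero_mul _))]
  change PowerSeries.X + PowerSeries.C dualEps * PowerSeries.X ^ (k + 2) -
    PowerSeries.C dualEps * PowerSeries.X ^ (k + 2) = PowerSeries.X
  rw [add_sub_cancel_right]

/-- **`ρ_k(g⁻¹) = T − ε T^{k+2}`**: the inverse of `g` maps to the inverse of `g_k` (uniqueness of the compositional
inverse). [cite: Lazard1955, §III] -/
theorem map_dualHom_expSeries (k : ℕ) : PowerSeries.map (dualHom k) expSeries = hSer k := by
  -- `g_k(χ_k) = T` by mapping `g(g⁻¹) = T`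
  have hχ0 : (PowerSeries.map (dualHom k) expSeries).constantCoeff = 0 := by
    rw [← PowerSeries.coeff_zero_eq_constantCoeff_apply, PowerSeries.coeff_map, PowerSeries.coeff_zero_eq_constantCoeff_apply,
      expSeries_spec.1, map_zero]
  have hχ : PowerSeries.HasSubst (PowerSeries.map (dualHom k) expSeries) := PowerSeries.HasSubst.of_constantCoeff_zero' hχ0
  have key : PowerSeries.subst (PowerSeries.map (dualHom k) expSeries : MvPowerSeries Unit (TrivSqZeroExt ℤ ℤ)) (gSer k) =
      PowerSeries.X := by
    have h := congrArg (MvPowerSeries.map (dualHom k)) expSeries_spec.2.2.1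
    rw [PowerSeries.map_subst (PowerSeries.HasSubst.of_constantCoeff_zero' expSeries_spec.1), map_dualHom_logSeries] at h
    rw [show (PowerSeries.map (dualHom k) expSeries : MvPowerSeries Unit (TrivSqZeroExt ℤ ℤ)) =
      MvPowerSeries.map (dualHom k) expSeries from rfl, h]
    exact PowerSeries.map_X (dualHom k)
  have hg : PowerSeries.HasSubst (gSer k) := PowerSeries.HasSubst.of_constantCoeff_zero' (constantCoeff_gSer k)
  calc PowerSeries.map (dualHom k) expSeries
      = PowerSeries.subst (PowerSeries.map (dualHom k) expSeries : MvPowerSeries Unit (TrivSqZeroExt ℤ ℤ)) PowerSeries.X :=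
        (PowerSeries.subst_X hχ).symm
    _ = PowerSeries.subst (PowerSeries.map (dualHom k) expSeries : MvPowerSeries Unit (TrivSqZeroExt ℤ ℤ))
          (PowerSeries.subst (gSer k) (hSer k)) := by rw [subst_gSer_hSer]
    _ = hSer k := by rw [PowerSeries.subst_comp_subst_apply hg hχ, key, PowerSeries.X_subst]

/-! ## §3 `H_b` in `ℤ[ε]/ε²`: `X + Y − ε((X+Y)^m − X^m − Y^m)` -/

/-- The identity `g(g⁻¹(T)) = T` survives base change (plumbing). [cite: Lazard1955, §II (2.9)] -/
private theorem subst_map_map_eq_X {R S : Type*} [CommRing R] [CommRing S] {ψ χ : PowerSeries R}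
    (hχ : χ.constantCoeff = 0) (hψχ : PowerSeries.subst χ ψ = PowerSeries.X) (h : R →+* S) :
    PowerSeries.subst (PowerSeries.map h χ) (PowerSeries.map h ψ) = PowerSeries.X := by
  have key := congrArg (MvPowerSeries.map h) hψχ
  rw [PowerSeries.map_subst (PowerSeries.HasSubst.of_constantCoeff_zero' hχ)] at key
  rw [show (PowerSeries.map h χ : MvPowerSeries Unit S) = MvPowerSeries.map h χ from rfl, key]
  exact PowerSeries.map_X h

/-- The additive law is preserved by base change (plumbing): `(𝔾ₐ.map h)(u,v) = u + v`. [cite: Hazewinkel1978, §1.1 (1.1.6)] -/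
private theorem subst_Ga_map {R S : Type*} [CommRing R] [CommRing S] (h : R →+* S) {τ : Type*}
    {u v : MvPowerSeries τ S} (huv : HasSubst ![u, v]) :
    (FormalGroup.𝔾ₐ.map h).toPowerSeries.subst ![u, v] = u + v := by
  rw [FormalGroup.map_toPowerSeries, FormalGroup.𝔾ₐ_toPowerSeries, map_add, MvPowerSeries.map_X, MvPowerSeries.map_X,
    MvPowerSeries.subst_add huv, MvPowerSeries.subst_X huv, MvPowerSeries.subst_X huv]
  rfl

/-- **`H_b` read in `ℤ[ε]/ε²` through `ρ_k`** (`m = k + 2`):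
`ρ_k(H_b)(X,Y) = X + Y + ε (X^m + Y^m) − ε (X + Y)^m`. [cite: Lazard1955, §III] -/
theorem toPowerSeries_addLaw_map_dualHom (k : ℕ) :
    (addLaw.map (dualHom k)).toPowerSeries =
      MvPowerSeries.X 0 + MvPowerSeries.X 1 +
        MvPowerSeries.C dualEps * (MvPowerSeries.X 0 ^ (k + 2) + MvPowerSeries.X 1 ^ (k + 2)) -
        MvPowerSeries.C dualEps * (MvPowerSeries.X 0 + MvPowerSeries.X 1) ^ (k + 2) := by
  have hmap := map_transportSeries FormalGroup.𝔾ₐ (dualHom k) (ψ := logSeries) (χ := expSeries) constantCoeff_logSeries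
  rw [addLaw, FormalGroup.map_toPowerSeries, transport_toPowerSeries, hmap, map_dualHom_logSeries, map_dualHom_expSeries,
    transportSeries]
  have hX : ∀ i : Fin 2, PowerSeries.HasSubst (MvPowerSeries.X i : MvPowerSeries (Fin 2) (TrivSqZeroExt ℤ ℤ)) :=
    fun i => PowerSeries.HasSubst.X i
  rw [subst_gSer k (hX 0), subst_gSer k (hX 1)]
  set E : MvPowerSeries (Fin 2) (TrivSqZeroExt ℤ ℤ) :=
    MvPowerSeries.C dualEps * (MvPowerSeries.X 0 ^ (k + 2) + MvPowerSeries.X 1 ^ (k + 2)) with hE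
  have hE0 : MvPowerSeries.constantCoeff E = 0 := by
    rw [hE, map_mul, map_add, map_pow, map_pow, MvPowerSeries.constantCoeff_X, MvPowerSeries.constantCoeff_X,
      zero_pow (by omega), add_zero, mul_zero]
  have hu : MvPowerSeries.constantCoeff (MvPowerSeries.X 0 + MvPowerSeries.C dualEps * MvPowerSeries.X 0 ^ (k + 2) :
      MvPowerSeries (Fin 2) (TrivSqZeroExt ℤ ℤ)) = 0 := by
    rw [map_add, map_mul, map_pow, MvPowerSeries.constantCoeff_X, zero_pow (by omega), mul_zero, add_zero]
  have hv : MvPowerSeries.constantCoeff (MvPowerSeries.X 1 + MvPowerSeries.C dualEps * MvPowerSeries.X 1 ^ (k + 2) :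
      MvPowerSeries (Fin 2) (TrivSqZeroExt ℤ ℤ)) = 0 := by
    rw [map_add, map_mul, map_pow, MvPowerSeries.constantCoeff_X, zero_pow (by omega), mul_zero, add_zero]
  have huv : HasSubst ![(MvPowerSeries.X 0 + MvPowerSeries.C dualEps * MvPowerSeries.X 0 ^ (k + 2) :
      MvPowerSeries (Fin 2) (TrivSqZeroExt ℤ ℤ)), MvPowerSeries.X 1 + MvPowerSeries.C dualEps * MvPowerSeries.X 1 ^ (k + 2)] :=
    MvPowerSeries.hasSubst_of_constantCoeff_zero fun i => by fin_cases i <;> assumption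
  rw [subst_Ga_map (dualHom k) huv]
  have hsum : (MvPowerSeries.X 0 + MvPowerSeries.C dualEps * MvPowerSeries.X 0 ^ (k + 2) +
      (MvPowerSeries.X 1 + MvPowerSeries.C dualEps * MvPowerSeries.X 1 ^ (k + 2)) :
        MvPowerSeries (Fin 2) (TrivSqZeroExt ℤ ℤ)) = (MvPowerSeries.X 0 + MvPowerSeries.X 1) + E := by
    rw [hE]; ring
  rw [hsum]
  have hS : PowerSeries.HasSubst ((MvPowerSeries.X 0 + MvPowerSeries.X 1 : MvPowerSeries (Fin 2) (TrivSqZeroExt ℤ ℤ)) + E) :=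
    PowerSeries.HasSubst.of_constantCoeff_zero (by
      rw [map_add, map_add, MvPowerSeries.constantCoeff_X, MvPowerSeries.constantCoeff_X, hE0, add_zero, add_zero])
  rw [subst_hSer k hS, mul_add_pow_of_mul_eq_zero' _ _ _ (by
    rw [hE, ← mul_assoc, C_dualEps_mul_C_dualEps, zero_mul])]

/-- **The coefficients of `ρ_k(H_b)` at interior exponents**: `−C(m, d₀)·ε` in degree `m = k + 2`, `0` in the other
degrees. [cite: Lazard1955, §III] -/
theorem coeff_addLaw_map_dualHom (k : ℕ) {d : Fin 2 →₀ ℕ} (hd : 0 < d 0 ∧ 0 < d 1) :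
    coeff d (addLaw.map (dualHom k)).toPowerSeries =
      if d 0 + d 1 = k + 2 then TrivSqZeroExt.inr (-((k + 2).choose (d 0) : ℤ)) else 0 := by
  classical
  rw [toPowerSeries_addLaw_map_dualHom, map_sub, map_add, map_add, MvPowerSeries.coeff_X, MvPowerSeries.coeff_X,
    MvPowerSeries.coeff_C_mul, MvPowerSeries.coeff_C_mul, map_add, MvPowerSeries.coeff_X_pow, MvPowerSeries.coeff_X_pow]
  have h1 : ¬ d = Finsupp.single 0 1 := by rintro rfl; simp at hd
  have h2 : ¬ d = Finsupp.single 1 1 := by rintro rfl; simp at hd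
  have h3 : ¬ d = Finsupp.single 0 (k + 2) := by rintro rfl; simp at hd
  have h4 : ¬ d = Finsupp.single 1 (k + 2) := by rintro rfl; simp at hd
  rw [if_neg h1, if_neg h2, if_neg h3, if_neg h4, add_zero, mul_zero, add_zero, zero_sub]
  -- the binomial expansion
  rw [add_pow, map_sum]
  have hmon : ∀ a : ℕ, coeff d ((MvPowerSeries.X 0 ^ a * MvPowerSeries.X 1 ^ (k + 2 - a) *
      (((k + 2).choose a : ℕ) : MvPowerSeries (Fin 2) (TrivSqZeroExt ℤ ℤ)))) =
      if d = Finsupp.single 0 a + Finsupp.single 1 (k + 2 - a) then (((k + 2).choose a : ℕ) : TrivSqZeroExt ℤ ℤ) else 0 := by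
    intro a
    rw [MvPowerSeries.X_pow_eq, MvPowerSeries.X_pow_eq, MvPowerSeries.monomial_mul_monomial, one_mul,
      ← map_natCast (MvPowerSeries.C (σ := Fin 2) (R := TrivSqZeroExt ℤ ℤ)), MvPowerSeries.coeff_mul_C, MvPowerSeries.coeff_monomial]
    split_ifs <;> simp
  simp_rw [hmon]
  by_cases hs : d 0 + d 1 = k + 2
  · rw [if_pos hs, Finset.sum_eq_single_of_mem (d 0) (Finset.mem_range.mpr (by omega))]
    · rw [if_pos (by ext s; fin_cases s <;> simp; omega)]
      ext <;> simp [dualEps]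
    · intro a _ ha
      rw [if_neg]
      intro h
      exact ha (by simpa using (congrArg (fun e => e 0) h).symm)
  · rw [if_neg hs, Finset.sum_eq_zero, mul_zero, neg_zero]
    intro a ha
    rw [Finset.mem_range] at ha
    rw [if_neg]
    intro h
    have h0 := congrArg (fun e => e 0) h
    have h1 := congrArg (fun e => e 1) h
    simp at h0 h1
    omega

/-- `ρ_k(Φ(ā_d))` for interior `d`: `−C(k+2, d₀)·ε` if `|d| = k + 2`, else `0`. [cite: Lazard1955, §III] -/
theorem dualHom_phiHom_gen (k : ℕ) {d : Fin 2 →₀ ℕ} (hd : 0 < d 0 ∧ 0 < d 1) :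
    dualHom k (phiHom (gen d)) = if d 0 + d 1 = k + 2 then TrivSqZeroExt.inr (-((k + 2).choose (d 0) : ℤ)) else 0 := by
  rw [phiHom_gen hd, ← coeff_addLaw_map_dualHom k hd, FormalGroup.map_toPowerSeries, MvPowerSeries.coeff_map]

/-- Lazard's `ν(m)` as a Bezout combination: `Σ_{0<b<m} w_b C(m,b) = ν(m)` (`m ≥ 2`). [cite: Lazard1955, §II (2.3)] -/
theorem sum_bezout_mul_choose {m : ℕ} (hm : 2 ≤ m) :
    ∑ b ∈ Ioo 0 m, bezout m b * (m.choose b : ℤ) = lazardNu m := by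
  have hsub : Ioo 0 m ⊆ range m := fun b hb => by rw [mem_Ioo] at hb; exact mem_range.mpr hb.2
  calc ∑ b ∈ Ioo 0 m, bezout m b * (m.choose b : ℤ)
      = ∑ b ∈ Ioo 0 m, (lazardNu m : ℤ) * (bezout m b * (cocycleCoeff m b : ℤ)) := by
        refine sum_congr rfl fun b hb => ?_
        rw [mem_Ioo] at hb
        rw [← lazardNu_mul_cocycleCoeff hb.1 hb.2]; push_cast; ring
    _ = (lazardNu m : ℤ) * ∑ b ∈ range m, bezout m b * (cocycleCoeff m b : ℤ) := by
        rw [← mul_sum, ← sum_subset hsub]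
        intro b hb hb'
        rw [mem_range] at hb; rw [mem_Ioo] at hb'
        rw [cocycleCoeff_of_not (by omega)]; simp
    _ = lazardNu m := by rw [bezout_spec hm, mul_one]

/-- **`ρ_k(Φ(t_m)) = −[m = k+2]·ν(m)·ε`** for Lazard's generator `t_m` (`m ≥ 2`). [cite: Lazard1955, §III (p. 263)] -/
theorem dualHom_phiHom_tGen (k : ℕ) {m : ℕ} (hm : 2 ≤ m) :
    dualHom k (phiHom (tGen m)) = if m = k + 2 then TrivSqZeroExt.inr (-(lazardNu m : ℤ)) else 0 := by
  rw [tGen, map_sum, map_sum]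
  have hterm : ∀ b ∈ Ioo 0 m, dualHom k (phiHom (bezout m b • gen (Finsupp.single 0 b + Finsupp.single 1 (m - b)))) =
      if m = k + 2 then TrivSqZeroExt.inr (-(bezout m b * (m.choose b : ℤ))) else 0 := by
    intro b hb
    rw [mem_Ioo] at hb
    rw [map_zsmul, map_zsmul, dualHom_phiHom_gen k (by simp; omega)]
    simp only [Finsupp.coe_add, Pi.add_apply, Finsupp.single_eq_same,
      Finsupp.single_eq_of_ne (show (0 : Fin 2) ≠ 1 by decide), Finsupp.single_eq_of_ne (show (1 : Fin 2) ≠ 0 by decide),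
      add_zero, zero_add, show (b + (m - b) = k + 2) ↔ (m = k + 2) by omega]
    split_ifs with h
    · subst h
      rw [← TrivSqZeroExt.inr_smul, smul_neg, smul_eq_mul]
    · rw [smul_zero]
  rw [sum_congr rfl hterm]
  split_ifs with h
  · subst h
    simp_rw [← sum_bezout_mul_choose hm, ← Finset.sum_neg_distrib]
    change ∑ x ∈ Ioo 0 (k + 2), TrivSqZeroExt.inrHom ℤ ℤ _ = TrivSqZeroExt.inrHom ℤ ℤ _
    rw [map_sum]
  · exact sum_const_zero

/-! ## §4 The constant and linear coefficients of `Φ(t_m)` -/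

/-- **`Φ(t_m)` has no constant term** (`m ≥ 2`). [cite: Lazard1955, §III (p. 263)] -/
theorem coeff_zero_phiHom_tGen {m : ℕ} (hm : 2 ≤ m) : MvPolynomial.coeff 0 (phiHom (tGen m)) = 0 := by
  rw [← fst_dualHom 0, dualHom_phiHom_tGen 0 hm]
  split_ifs <;> rfl

/-- **The linear part of `Φ(t_m)` is `−ν(m)·b_{m−2}`**: the coefficient of `b_k` in `Φ(t_m)` is `−ν(m)` if `m = k + 2`
and `0` otherwise (`m ≥ 2`). [cite: Lazard1955, §III (p. 263)] -/
theorem coeff_single_phiHom_tGen {m : ℕ} (hm : 2 ≤ m) (k : ℕ) :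
    MvPolynomial.coeff (Finsupp.single k 1) (phiHom (tGen m)) = if m = k + 2 then -(lazardNu m : ℤ) else 0 := by
  rw [← snd_dualHom k, dualHom_phiHom_tGen k hm]
  split_ifs <;> rfl

end LazardRing

end Literature.RingTheory.FormalGroups
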